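import Summits.CriticalPhenomena.PercolationContinuityZ3.Theorems.PercShatteringRaceJumpUniquenessBoxLRO
import Literature.Probability.Percolation.CerfUniquenessZoneBound
import Literature.Probability.Percolation.QuantitativeGMConnections
import Literature.Probability.Percolation.CriticalContinuityProofs
import Literature.Probability.Percolation.KestenZhangBlocks
import HarnessLib

/-!
# Crux `PercShatteringRace.NearLinearTwoClusterDecay` (stmt-CriticalPhenomena-5785) — engine stub E2 `stub_relayChain`, auxiliary file

Helper file of the line `pair-decay-long-arms-dense` (lead c5); lands with `--supports stmt-CriticalPhenomena-5785`
(registered auxiliary stub `stub_relayChainAux` = the deterministic relay-chain inclusion below). The probabilistic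
assembly of `stub_relayChain` is the sequel file `PercShatteringRaceNearLinearTwoClusterDecayStubRelayChain.lean`.

## Contents (bond percolation on `ℤ³`, all deterministic or pure real analysis)

* `exists_relayCentres` — GEOMETRY: for `r ≥ 1` and `a, b ∈ Λ_u` a chain of relay centres
  `z 0 = a, z 1, …` in `Λ_u`, constant `= b` from the index `2u/r + 1` on, consecutive centres at
  sup-distance `≤ r` (every coordinate moves monotonically from `a i` to `b i` by `r` per step).
* `link` — ONE LINK: if `w, w' ∈ z + Λ_{2r}` both lie in infinite open clusters of a lattice configuration
  `ω`, and the translate `ω - z` lies in the uniqueness zone `uniqZone (2r) M` (`2r ≤ M`), then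
  `w ↔ w'` inside `z + Λ_M`: after the shift by `-z` both points reach `∂Λ_M` inside `Λ_M` (first exit,
  `toBdry_of_percolatesAt`), so the uniqueness zone joins them inside `Λ_M`; transfer back with
  `DKT20.relabel_shift_mem_openConnIn_iff`.
* `mem_openConnIn_of_relay` / `stub_relayChainAux` — EVENT INCLUSION: along a chain of relay centres in
  `Λ_u` with steps `≤ r`, if every relay ball `z j + Λ_r` (`j ≤ J`) meets an infinite cluster, every
  translate `ω - z j` lies in `uniqZone (2r) M`, and the endpoints percolate, then `z 0 ↔ z J` inside
  `Λ_N` whenever `u + M ≤ N` (chain the links with `GM.openConnIn_trans`, enlarge `z j + Λ_M ⊆ Λ_N`).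
* `eventually_mul_rpow_le_rpow_div_three`, `eventually_mul_rpow_le_of_neg` — REAL ANALYSIS: for
  `e < x`, eventually `c u^e ≤ u^x / 3`; for `e < 0 < ε`, eventually `c u^e ≤ ε` (`u : ℕ → ∞`).

This is the bond-percolation transcription of the relay step in R. Cerf, *A lower bound on the two-arms
exponent for critical percolation on the lattice*, Ann. Probab. 43 (2015), §10 (proof of Theorem 1.3 from
Lemma 10.1), with the uniqueness zone of Martineau–Tassion (`UniquenessZone.lean`) as the gluing device.

## References

* R. Cerf, Ann. Probab. 43 (2015) 2458–2480, arXiv:1306.3105, Lemma 10.1 and §10 [Cerf2015].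
* S. Martineau, V. Tassion, Ann. Probab. 45 (2017), proof of Lemma 3.7 (uniqueness zone) [MartineauTassion2017].
* G. Grimmett, *Percolation*, 2nd ed., Springer 1999, §1.6 (translation invariance), §7.2 [GrimmettPercolation1999].
-/

noncomputable section

namespace Summit.CriticalPhenomena.PercolationContinuityZ3.Theorems

namespace NearLinearTwoClusterDecayRelayChain

open MeasureTheory Filter Topology
open Literature.Probability.LatticeModels Literature.Probability.Percolation

/-! ## Geometry: the relay centres -/

/-- **Relay centres.** For `r ≥ 1` and `a, b ∈ Λ_u` there is a chain `z 0 = a, z 1, …` in `Λ_u`,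
constant `= b` from the index `2u/r + 1` on, with consecutive centres at sup-distance `≤ r`
(move every coordinate monotonically from `a i` towards `b i` by `r` per step). [folklore] -/
theorem exists_relayCentres (u r : ℕ) (hr : 1 ≤ r) {a b : Site 3} (ha : a ∈ box 3 u)
    (hb : b ∈ box 3 u) :
    ∃ z : ℕ → Site 3, z 0 = a ∧ (∀ j, 2 * u / r + 1 ≤ j → z j = b) ∧ (∀ j, z j ∈ box 3 u) ∧
      ∀ j, z (j + 1) ∈ GM.ball (z j) r := by
  refine ⟨fun j i => if a i ≤ b i then min (a i + ((j * r : ℕ) : ℤ)) (b i)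
    else max (a i - ((j * r : ℕ) : ℤ)) (b i), ?_, ?_, ?_, ?_⟩
  · funext i
    simp only [zero_mul, Nat.cast_zero, add_zero, sub_zero]
    split_ifs with h
    · exact min_eq_left h
    · exact max_eq_left (le_of_not_ge h)
  · intro j hj
    funext i
    have hai := (mem_box.1 ha) i
    have hbi := (mem_box.1 hb) i
    have hjr : 2 * u < j * r := by
      calc 2 * u < 2 * u / r * r + r := Nat.lt_div_mul_add (by omega)
        _ = (2 * u / r + 1) * r := by ring
        _ ≤ j * r := Nat.mul_le_mul_right r hj
    have hjr' : (2 * u : ℤ) < ((j * r : ℕ) : ℤ) := by exact_mod_cast hjr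
    generalize ((j * r : ℕ) : ℤ) = k at hjr' ⊢
    simp only
    split_ifs with h
    · apply min_eq_right; omega
    · apply max_eq_right; omega
  · intro j
    rw [mem_box]
    intro i
    have hai := (mem_box.1 ha) i
    have hbi := (mem_box.1 hb) i
    have h0 : (0 : ℤ) ≤ ((j * r : ℕ) : ℤ) := Nat.cast_nonneg _
    simp only
    generalize ((j * r : ℕ) : ℤ) = k at h0 ⊢
    split_ifs with h <;> constructor <;> omega
  · intro j
    rw [GM.mem_ball]
    intro i
    have hk : (((j + 1) * r : ℕ) : ℤ) = ((j * r : ℕ) : ℤ) + r := by push_cast; ring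
    simp only
    rw [hk]
    generalize ((j * r : ℕ) : ℤ) = k
    split_ifs with h <;> constructor <;> omega

/-! ## One link: two infinite strands near a relay centre are joined inside the uniqueness zone -/

/-- A point of `z + Λ_m` becomes a point of `Λ_m` after the shift by `-z`. [folklore] -/
theorem add_neg_mem_box_of_mem_ball {z v : Site 3} {m : ℕ} (hv : v ∈ GM.ball z m) : v + -z ∈ box 3 m := by
  rw [GM.mem_ball] at hv
  rw [mem_box]
  intro i
  have := hv i
  simp only [Pi.add_apply, Pi.neg_apply]
  omega

/-- **One link of the relay** (Cerf 2015 §10, with the Martineau–Tassion uniqueness zone as gluing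
device): for a lattice configuration `ω`, if `w, w' ∈ z + Λ_{2r}` both lie in infinite open clusters and
the translate `ω - z` lies in `uniqZone (2r) M` with `2r ≤ M`, then `w ↔ w'` inside `z + Λ_M`. After
the shift both points are joined inside `Λ_M` to `∂Λ_M` (first exit of the infinite paths,
`toBdry_of_percolatesAt`), hence to each other. [cite: Cerf2015, §10 (proof of Theorem 1.3)] -/
theorem link {z w w' : Site 3} {r M : ℕ} (hrM : 2 * r ≤ M) {ω : BondConfig (Site 3)}
    (hω : ω ⊆ (zdGraph 3).edgeSet) (hw : w ∈ GM.ball z (2 * r)) (hw' : w' ∈ GM.ball z (2 * r))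
    (hpw : ω ∈ percolatesAt w) (hpw' : ω ∈ percolatesAt w')
    (hU : BondConfig.relabel (sym2Equiv (Site.shift (-z))) ω ∈ @uniqZone 3 (2 * r) M) :
    ω ∈ openConnIn (↑(GM.ball z M) : Set (Site 3)) w w' := by
  set ω' := BondConfig.relabel (sym2Equiv (Site.shift (-z))) ω with hω'def
  have hω' : ω' ⊆ (zdGraph 3).edgeSet := KestenZhang.relabel_subset_edgeSet (zdShiftIso (-z)) hω
  have hperc : ∀ v, ω ∈ percolatesAt v → ω' ∈ percolatesAt (v + -z) := fun v hv => by
    have h := preimage_relabel_shift_percolatesAt (-z) v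
    rw [← h] at hv
    exact hv
  have hB := box_mono 3 hrM
  have h1 : ω' ∈ openConnIn (↑(box 3 M) : Set (Site 3)) (w + -z) (w' + -z) :=
    hU (w + -z) (add_neg_mem_box_of_mem_ball hw) (w' + -z) (add_neg_mem_box_of_mem_ball hw')
      (toBdry_of_percolatesAt (hB (add_neg_mem_box_of_mem_ball hw)) hω' (hperc w hpw))
      (toBdry_of_percolatesAt (hB (add_neg_mem_box_of_mem_ball hw')) hω' (hperc w' hpw'))
  have h2 := (DKT20.relabel_shift_mem_openConnIn_iff z M (w + -z) (w' + -z) ω).1 h1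
  simpa only [neg_add_cancel_right] using h2

/-! ## The event inclusion: chaining the links -/

/-- **The relay chain joins its endpoints.** Let `z 0, z 1, …` be relay centres in `Λ_u` with steps of
sup-norm `≤ r`, `2r ≤ M`, `u + M ≤ N`, and let `ω` be a lattice configuration in which `z 0` and `z J`
percolate, every relay ball `z j + Λ_r` (`j ≤ J`) meets an infinite open cluster, and every translate
`ω - z j` (`j ≤ J`) lies in `uniqZone (2r) M`. Then `z 0 ↔ z J` inside `Λ_N`: consecutive infinite
strands both meet `z j + Λ_{2r}`, so `link` joins them inside `z j + Λ_M ⊆ Λ_N`; chain with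
`GM.openConnIn_trans`. [cite: Cerf2015, §10 (proof of Theorem 1.3)] -/
theorem mem_openConnIn_of_relay {u r M N J : ℕ} (hrM : 2 * r ≤ M) (hMN : u + M ≤ N) {z : ℕ → Site 3}
    (hzbox : ∀ j, z j ∈ box 3 u) (hzstep : ∀ j, z (j + 1) ∈ GM.ball (z j) r) {ω : BondConfig (Site 3)}
    (hω : ω ⊆ (zdGraph 3).edgeSet) (ha : ω ∈ percolatesAt (z 0)) (hb : ω ∈ percolatesAt (z J))
    (hocc : ∀ j ≤ J, ∃ w ∈ GM.ball (z j) r, ω ∈ percolatesAt w)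
    (hU : ∀ j ≤ J, BondConfig.relabel (sym2Equiv (Site.shift (-(z j)))) ω ∈ @uniqZone 3 (2 * r) M) :
    ω ∈ openConnIn (↑(box 3 N) : Set (Site 3)) (z 0) (z J) := by
  choose! w hw using hocc
  have hreg : ∀ j, (↑(GM.ball (z j) M) : Set (Site 3)) ⊆ ↑(box 3 N) := fun j v hv => by
    rw [Finset.mem_coe, GM.mem_ball] at hv
    rw [Finset.mem_coe, mem_box]
    have hzj := mem_box.1 (hzbox j)
    have h3 : (u : ℤ) + M ≤ N := by exact_mod_cast hMN
    intro i
    have h1 := hv i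
    have h2 := hzj i
    constructor <;> omega
  have hball_mono : ∀ j, ∀ v ∈ GM.ball (z j) r, v ∈ GM.ball (z j) (2 * r) := fun j v hv => by
    rw [GM.mem_ball] at hv ⊢
    intro i
    have := hv i
    push_cast
    constructor <;> omega
  have hball_step : ∀ j, ∀ v ∈ GM.ball (z (j + 1)) r, v ∈ GM.ball (z j) (2 * r) := fun j v hv => by
    have hs := hzstep j
    rw [GM.mem_ball] at hv hs ⊢
    intro i
    have h1 := hv i
    have h2 := hs i
    push_cast
    constructor <;> omega
  -- `{v ↔ v' in S}` is monotone in the region `S` (as `RSW.lean`'s `openConnIn_mono`)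
  have hmono : ∀ {T T' : Set (Site 3)}, T ⊆ T' → ∀ {v v' : Site 3},
      ω ∈ openConnIn T v v' → ω ∈ openConnIn T' v v' := by
    intro T T' h v v' hc
    obtain ⟨hv, hv', hr⟩ := hc
    exact ⟨h hv, h hv', hr.map (SimpleGraph.induceHomOfLE (G := openGraph ω) h).toHom⟩
  have hlink : ∀ j ≤ J, ∀ v v', v ∈ GM.ball (z j) (2 * r) → v' ∈ GM.ball (z j) (2 * r) →
      ω ∈ percolatesAt v → ω ∈ percolatesAt v' → ω ∈ openConnIn (↑(box 3 N) : Set (Site 3)) v v' :=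
    fun j hj v v' hv hv' hpv hpv' => hmono (hreg j) (link hrM hω hv hv' hpv hpv' (hU j hj))
  have hchain : ∀ j ≤ J, ω ∈ openConnIn (↑(box 3 N) : Set (Site 3)) (z 0) (w j) := by
    intro j
    induction j with
    | zero =>
      intro hj
      exact hlink 0 hj (z 0) (w 0) (GM.self_mem_ball _ _) (hball_mono 0 _ (hw 0 hj).1) ha (hw 0 hj).2
    | succ j ih =>
      intro hj
      have hj' : j ≤ J := Nat.le_of_succ_le hj
      exact GM.openConnIn_trans (ih hj')
        (hlink j hj' (w j) (w (j + 1)) (hball_mono j _ (hw j hj').1) (hball_step j _ (hw (j + 1) hj).1)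
          (hw j hj').2 (hw (j + 1) hj).2)
  exact GM.openConnIn_trans (hchain J le_rfl)
    (hlink J le_rfl (w J) (z J) (hball_mono J _ (hw J le_rfl).1) (GM.self_mem_ball _ _) (hw J le_rfl).2 hb)

/-! ## Real analysis: polynomial comparisons along `u : ℕ → ∞` -/

/-- For real exponents `e < x` and any real `c`, eventually `c u^e ≤ u^x / 3` (`u : ℕ → ∞`):
`u^x = u^{x-e} u^e` with `u^{x-e} → ∞`. [folklore] -/
theorem eventually_mul_rpow_le_rpow_div_three (c : ℝ) {e x : ℝ} (hex : e < x) :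
    ∀ᶠ u : ℕ in atTop, c * (u : ℝ) ^ e ≤ (u : ℝ) ^ x / 3 := by
  have ht : Tendsto (fun u : ℕ => (u : ℝ) ^ (x - e)) atTop atTop :=
    (tendsto_rpow_atTop (by linarith)).comp tendsto_natCast_atTop_atTop
  filter_upwards [ht.eventually_ge_atTop (3 * c), eventually_ge_atTop 1] with u hu hu1
  have hu0 : (0 : ℝ) < u := by exact_mod_cast hu1
  have hsplit : (u : ℝ) ^ x = (u : ℝ) ^ (x - e) * (u : ℝ) ^ e := by
    rw [← Real.rpow_add hu0, sub_add_cancel]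
  rw [hsplit]
  have he0 : 0 ≤ (u : ℝ) ^ e := Real.rpow_nonneg hu0.le e
  have := mul_le_mul_of_nonneg_right hu he0
  linarith

/-- For a real exponent `e < 0`, any real `c` and `ε > 0`, eventually `c u^e ≤ ε` (`u : ℕ → ∞`).
[folklore] -/
theorem eventually_mul_rpow_le_of_neg (c : ℝ) {e ε : ℝ} (he : e < 0) (hε : 0 < ε) :
    ∀ᶠ u : ℕ in atTop, c * (u : ℝ) ^ e ≤ ε := by
  have h1 : Tendsto (fun y : ℝ => y ^ (-(-e))) atTop (𝓝 0) := tendsto_rpow_neg_atTop (by linarith)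
  rw [neg_neg] at h1
  have ht : Tendsto (fun u : ℕ => c * (u : ℝ) ^ e) atTop (𝓝 (c * 0)) :=
    (h1.comp tendsto_natCast_atTop_atTop).const_mul c
  rw [mul_zero] at ht
  exact ht.eventually (ge_mem_nhds hε)

end NearLinearTwoClusterDecayRelayChain

open MeasureTheory Filter Topology
open Literature.Probability.LatticeModels Literature.Probability.Percolation
open NearLinearTwoClusterDecayRelayChain

/-- **Auxiliary stub `stub_relayChainAux` of engine stub E2 `stub_relayChain`** (registered): the
deterministic relay-chain inclusion `NearLinearTwoClusterDecayRelayChain.mem_openConnIn_of_relay` — along relay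
centres in `Λ_u` with steps `≤ r`, occupied relay balls, translated uniqueness zones `uniqZone (2r) M`
(`2r ≤ M`, `u + M ≤ N`) and percolating endpoints force `z 0 ↔ z J` inside `Λ_N`.
[cite: Cerf2015, §10 (proof of Theorem 1.3)] -/
theorem stub_relayChainAux :
    ∀ (u r M N J : ℕ), 2 * r ≤ M → u + M ≤ N → ∀ (z : ℕ → Site 3), (∀ j, z j ∈ box 3 u) →
    (∀ j, z (j + 1) ∈ GM.ball (z j) r) → ∀ ω : BondConfig (Site 3), ω ⊆ (zdGraph 3).edgeSet →
    ω ∈ percolatesAt (z 0) → ω ∈ percolatesAt (z J) →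
    (∀ j ≤ J, ∃ w ∈ GM.ball (z j) r, ω ∈ percolatesAt w) →
    (∀ j ≤ J, BondConfig.relabel (sym2Equiv (Site.shift (-(z j)))) ω ∈ @uniqZone 3 (2 * r) M) →
    ω ∈ openConnIn (↑(box 3 N) : Set (Site 3)) (z 0) (z J) :=
  fun _u _r _M _N _J hrM hMN _z hzbox hzstep _ω hω ha hb hocc hU =>
    mem_openConnIn_of_relay hrM hMN hzbox hzstep hω ha hb hocc hU

end Summit.CriticalPhenomena.PercolationContinuityZ3.Theorems
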